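import Literature.CategoryTheory.Abelian.BichainConditionFiniteLength
import Mathlib.CategoryTheory.Opposites
import Mathlib.CategoryTheory.Abelian.Subobject
import HarnessLib

/-!
# The bi-chain condition is self-dual (Atiyah 1956, §3); artinian objects with artinian opposite satisfy it in any category;
# in an abelian category `op X` is artinian iff `X` is noetherian

Topic `Literature/CategoryTheory/Abelian`, namespace `Literature.CategoryTheory.KrullSchmidt`.  Fifth file of the CHAIN-CONDITIONS story
(g41-#1 `Preadditive/BichainCondition`, g41-#2 `Abelian/BichainConditionFiniteLength`, g41-#3 `Abelian/FittingLemmaBichain`, g41-#4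
`Abelian/AtiyahKrullSchmidt`).  Atiyah remarks that the bi-chain condition is self-dual; we make this precise (a bi-chain of `C` is a
bi-chain of `Cᵒᵖ` with the roles of `αₙ`, `βₙ` exchanged), and use it to free the «ascending chain» half of Lemma 5.1 from abelianness:
the `αₙ` of a bi-chain starting at `X` are eventually invertible as soon as `op X` is an ARTINIAN object of `Cᵒᵖ` (chain condition on
quotient objects), in ANY category; in an abelian category `op X` is artinian iff `X` is noetherian (Mathlib's `Abelian.subobjectIsoSubobjectOp`).
Everything proved; two auxiliary definitions with bodies (`Bichain.op`, `Bichain.unop`), no named fact, no instance, no notation.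

## The sources, verbatim

Atiyah [Atiyah1956, §3]: «DEFINITION. The bi-chain condition holds in `𝔄` if every bi-chain of `𝔄` terminates.  We note that the bi-chain
condition is self-dual. Moreover, if `{Aₙ, iₙ, pₙ}` is a bi-chain of `𝔄`, `Im(iₙ)` is a descending chain and `Ker(pₙ)` is an ascending
chain. Hence the bi-chain condition holds in `𝔄` if the ascending and descending chain conditions both hold.»
Krause [Krause2015KS, §5 «Finite length objects»]: «Note that `X` has finite length if and only if `X` is both artinian (i.e. it satisfies
the descending chain condition on subobjects) and noetherian (i.e. it satisfies the ascending chain condition on subobjects).»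
**Lemma 5.1.** «An object of finite length satisfies the bi-chain condition.»

## What is formalised

* §1 `Bichain.op : Bichain C → Bichain Cᵒᵖ` (objects `op Xₙ`, `fwd n = (bwd n).op`, `bwd n = (fwd n).op`), `Bichain.unop : Bichain Cᵒᵖ →
  Bichain C`, and `eventuallyIso_op_iff`, `eventuallyIso_unop_iff` (termination is preserved).
* §2 **self-duality**: `BichainCondition.op`, `BichainCondition.unop`, **`bichainCondition_op_iff : BichainCondition (op X) ↔
  BichainCondition X`**, `bichainCondition_unop_iff`.
* §3 (ANY category) `Bichain.eventually_isIso_fwd_of_isArtinianObject_op`: if `op X` is artinian, the `αₙ` of a bi-chain from `X` are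
  eventually invertible (g41-#2's image-chain lemma applied to the opposite bi-chain); hence
  **`bichainCondition_of_isArtinianObject_of_isArtinianObject_op`**: `X` artinian and `op X` artinian ⟹ `X` satisfies the bi-chain condition
  — Lemma 5.1 with «noetherian in an abelian category» replaced by «artinian opposite», no exactness assumption on `C`.
* §4 (abelian) **`isArtinianObject_op_iff_isNoetherianObject : IsArtinianObject (op X) ↔ IsNoetherianObject X`** and
  **`isNoetherianObject_op_iff_isArtinianObject`** (through `Abelian.subobjectIsoSubobjectOp X : Subobject X ≃o (Subobject (op X))ᵒᵈ` and the
  chain-condition characterisations), `isArtinianObject_and_isNoetherianObject_op_iff` (finite length is self-dual), and the `αₙ`-half for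
  noetherian objects re-derived by duality (`Bichain.eventually_isIso_fwd_of_isNoetherianObject'`; g41-#2 proves it through kernels and
  pullbacks) — so g41-#2's Lemma 5.1 is the abelian case of §3.

NOT here: Mathlib's «future work» `isArtinianObject`∕`isNoetherianObject` as `ObjectProperty` statements about `Cᵒᵖ` beyond the two `iff`s.

## Mathlib ∕ Literature search

Mathlib: `Quiver.Hom.op`∕`unop`, `Iso.op`, `Iso.unop`, `op_mono_of_epi`, `op_epi_of_mono`, `unop_mono_of_epi`, `unop_epi_of_mono`,
`isIso_op_iff`, `isIso_unop_iff`, `Abelian.subobjectIsoSubobjectOp` (`CategoryTheory/Abelian/Subobject`: «the subobjects and quotient objects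
of an object `X` are order-isomorphic via taking kernels and cokernels»), `OrderIso.dualDual`, `isArtinianObject_iff_antitone_chain_condition`,
`isNoetherianObject_iff_monotone_chain_condition`; Mathlib's `Subobject/ArtinianObject.lean` lists «when `C` is an abelian category, relate
`IsArtinianObject` in `C` with `IsNoetherianObject` in `Cᵒᵖ`» as future work — §4 supplies it (`rg -n "IsArtinianObject (op|\(op"
Mathlib` → nothing).  Literature REUSED: g41-#1 (`Bichain`, `BichainCondition`, `EventuallyIso`), g41-#2
(`Bichain.eventually_isIso_bwd_of_isArtinianObject`).

## References

* M. Atiyah, *On the Krull-Schmidt theorem with application to sheaves*, Bull. Soc. Math. France 84 (1956) 307–317: §3 (remark after the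
  Definitions). [Atiyah1956]
* H. Krause, *Krull–Schmidt categories and projective covers*, Expo. Math. 33 (2015) 535–549, arXiv:1410.2822: §5 «Finite length objects»,
  Lemma 5.1. [Krause2015KS]

## Provenance

Lane `lit-hodgefound` (summit `HodgeConjecture`, Track 2 foundations library), seat `lit-hodgefound-p36` (literature-prover, generation 41,
row g41-#5); Atiyah materialised as `galaxy-pdf-4113901900` (scan p. 4 = p. 310), Krause as `paper-arxiv-1410.2822` (p0010).
-/

open CategoryTheory CategoryTheory.Limits Opposite

namespace Literature.CategoryTheory.KrullSchmidt

universe v u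

variable {C : Type u} [Category.{v} C]

namespace Bichain

/-! ## §1 Opposite bi-chains -/

/-- **The opposite bi-chain** (Atiyah: «We note that the bi-chain condition is self-dual»): objects `op Xₙ`, epimorphisms `βₙᵒᵖ`,
monomorphisms `αₙᵒᵖ`. [cite: Atiyah1956, §3 (remark after the Definitions)] -/
protected def op (B : Bichain C) : Bichain Cᵒᵖ where
  obj n := op (B.obj n)
  fwd n := (B.bwd n).op
  bwd n := (B.fwd n).op
  epi_fwd n := by haveI := B.mono_bwd n; infer_instance
  mono_bwd n := by haveI := B.epi_fwd n; infer_instance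

/-- **The bi-chain in `C` underlying a bi-chain of `Cᵒᵖ`**: objects `unop Xₙ`, epimorphisms `βₙ.unop`, monomorphisms `αₙ.unop`.
[cite: Atiyah1956, §3 (remark after the Definitions)] -/
protected def unop (B : Bichain Cᵒᵖ) : Bichain C where
  obj n := unop (B.obj n)
  fwd n := (B.bwd n).unop
  bwd n := (B.fwd n).unop
  epi_fwd n := by haveI := B.mono_bwd n; infer_instance
  mono_bwd n := by haveI := B.epi_fwd n; infer_instance

/-- Objects of the opposite bi-chain. [cite: Atiyah1956, §3 (remark after the Definitions)] -/
@[simp] theorem op_obj (B : Bichain C) (n : ℕ) : B.op.obj n = op (B.obj n) := rfl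

/-- Epimorphisms of the opposite bi-chain. [cite: Atiyah1956, §3 (remark after the Definitions)] -/
@[simp] theorem op_fwd (B : Bichain C) (n : ℕ) : B.op.fwd n = (B.bwd n).op := rfl

/-- Monomorphisms of the opposite bi-chain. [cite: Atiyah1956, §3 (remark after the Definitions)] -/
@[simp] theorem op_bwd (B : Bichain C) (n : ℕ) : B.op.bwd n = (B.fwd n).op := rfl

/-- Objects of the underlying bi-chain. [cite: Atiyah1956, §3 (remark after the Definitions)] -/
@[simp] theorem unop_obj (B : Bichain Cᵒᵖ) (n : ℕ) : B.unop.obj n = unop (B.obj n) := rfl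

/-- Epimorphisms of the underlying bi-chain. [cite: Atiyah1956, §3 (remark after the Definitions)] -/
@[simp] theorem unop_fwd (B : Bichain Cᵒᵖ) (n : ℕ) : B.unop.fwd n = (B.bwd n).unop := rfl

/-- Monomorphisms of the underlying bi-chain. [cite: Atiyah1956, §3 (remark after the Definitions)] -/
@[simp] theorem unop_bwd (B : Bichain Cᵒᵖ) (n : ℕ) : B.unop.bwd n = (B.fwd n).unop := rfl

/-- A bi-chain terminates iff its opposite does. [cite: Atiyah1956, §3 (remark after the Definitions)] -/
theorem eventuallyIso_op_iff (B : Bichain C) : B.op.EventuallyIso ↔ B.EventuallyIso := by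
  constructor
  · rintro ⟨n₀, h⟩
    refine ⟨n₀, fun n hn => ?_⟩
    obtain ⟨h1, h2⟩ := h n hn
    exact ⟨(isIso_op_iff _).1 h2, (isIso_op_iff _).1 h1⟩
  · rintro ⟨n₀, h⟩
    refine ⟨n₀, fun n hn => ?_⟩
    obtain ⟨h1, h2⟩ := h n hn
    exact ⟨(isIso_op_iff _).2 h2, (isIso_op_iff _).2 h1⟩

/-- A bi-chain of `Cᵒᵖ` terminates iff the underlying bi-chain of `C` does. [cite: Atiyah1956, §3 (remark after the Definitions)] -/
theorem eventuallyIso_unop_iff (B : Bichain Cᵒᵖ) : B.unop.EventuallyIso ↔ B.EventuallyIso := by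
  constructor
  · rintro ⟨n₀, h⟩
    refine ⟨n₀, fun n hn => ?_⟩
    obtain ⟨h1, h2⟩ := h n hn
    exact ⟨(isIso_unop_iff _).1 h2, (isIso_unop_iff _).1 h1⟩
  · rintro ⟨n₀, h⟩
    refine ⟨n₀, fun n hn => ?_⟩
    obtain ⟨h1, h2⟩ := h n hn
    exact ⟨(isIso_unop_iff _).2 h2, (isIso_unop_iff _).2 h1⟩

end Bichain

/-! ## §2 Self-duality of the bi-chain condition -/

namespace BichainCondition

/-- If `X` satisfies the bi-chain condition in `C`, then `op X` satisfies it in `Cᵒᵖ`. [cite: Atiyah1956, §3 (remark after the Definitions)] -/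
protected theorem op {X : C} (h : BichainCondition X) : BichainCondition (op X) := by
  rintro B ⟨e⟩
  exact B.eventuallyIso_unop_iff.1 (h B.unop ⟨e.unop.symm⟩)

/-- If `X : Cᵒᵖ` satisfies the bi-chain condition, then `unop X` satisfies it in `C`. [cite: Atiyah1956, §3 (remark after the Definitions)] -/
protected theorem unop {X : Cᵒᵖ} (h : BichainCondition X) : BichainCondition (unop X) := by
  rintro B ⟨e⟩
  exact B.eventuallyIso_op_iff.1 (h B.op ⟨e.op.symm⟩)

end BichainCondition

/-- **«The bi-chain condition is self-dual»**: `op X` satisfies the bi-chain condition in `Cᵒᵖ` iff `X` does in `C`.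
[cite: Atiyah1956, §3 (remark after the Definitions)] -/
theorem bichainCondition_op_iff (X : C) : BichainCondition (op X) ↔ BichainCondition X :=
  ⟨fun h => h.unop, fun h => h.op⟩

/-- Dually for objects of `Cᵒᵖ`. [cite: Atiyah1956, §3 (remark after the Definitions)] -/
theorem bichainCondition_unop_iff (X : Cᵒᵖ) : BichainCondition (unop X) ↔ BichainCondition X :=
  ⟨fun h => h.op, fun h => h.unop⟩

/-! ## §3 The ascending chain through the opposite category: `IsArtinianObject (op X)` controls the `αₙ` -/

/-- If `op X` is an ARTINIAN object of `Cᵒᵖ` (i.e. `X` has the descending chain condition on QUOTIENT objects), then in every bi-chain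
starting at `X` the epimorphisms `αₙ` are eventually invertible — in ANY category: the composite epimorphisms `γₙ : X ↠ Xₙ` are a descending
chain of subobjects of `op X` (Atiyah: «`Ker(pₙ)` is an ascending chain»; g41-#2 `eventually_isIso_bwd_of_isArtinianObject` applied to the
opposite bi-chain). [cite: Atiyah1956, §3 (remark after the Definitions)] [cite: Krause2015KS, §5 Lemma 5.1 (proof)] -/
theorem Bichain.eventually_isIso_fwd_of_isArtinianObject_op (B : Bichain C) {X : C} [IsArtinianObject (op X)] (e : X ≅ B.obj 0) :
    ∃ n₀ : ℕ, ∀ n, n₀ ≤ n → IsIso (B.fwd n) := by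
  obtain ⟨n₀, h⟩ := B.op.eventually_isIso_bwd_of_isArtinianObject (X := op X) e.op.symm
  exact ⟨n₀, fun n hn => (isIso_op_iff _).1 (h n hn)⟩

/-- **Lemma 5.1 without abelianness**: an object `X` of ANY category such that both `X` and `op X` are artinian (descending chain
conditions on subobjects and on quotient objects — Atiyah's «the bi-chain condition holds in `𝔄` if the ascending and descending chain
conditions both hold», read through the self-duality) satisfies the bi-chain condition. [cite: Atiyah1956, §3 (remark after the Definitions)]
[cite: Krause2015KS, §5 Lemma 5.1] -/
theorem bichainCondition_of_isArtinianObject_of_isArtinianObject_op (X : C) [IsArtinianObject X] [IsArtinianObject (op X)] :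
    BichainCondition X := by
  intro B ⟨e⟩
  obtain ⟨n₁, hn₁⟩ := B.eventually_isIso_bwd_of_isArtinianObject e
  obtain ⟨n₂, hn₂⟩ := B.eventually_isIso_fwd_of_isArtinianObject_op e
  exact ⟨max n₁ n₂, fun n hn => ⟨hn₂ n (le_of_max_le_right hn), hn₁ n (le_of_max_le_left hn)⟩⟩

/-! ## §4 Abelian categories: quotient objects are subobjects of the opposite, so `X` is noetherian iff `op X` is artinian -/

section Abelian

variable {D : Type u} [Category.{v} D] [Abelian D]

/-- In an abelian category, **`op X` is artinian iff `X` is noetherian** — the descending chain condition on quotient objects is the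
ascending chain condition on subobjects, through Mathlib's order isomorphism `Abelian.subobjectIsoSubobjectOp : Subobject X ≃o
(Subobject (op X))ᵒᵈ` (kernels ∕ cokernels).  This is the duality behind Atiyah's «the bi-chain condition is self-dual … `Im(iₙ)` is a
descending chain and `Ker(pₙ)` is an ascending chain» and Krause's «artinian … noetherian». [cite: Atiyah1956, §3 (remark after the Definitions)]
[cite: Krause2015KS, §5 «Finite length objects»] -/
theorem isArtinianObject_op_iff_isNoetherianObject (X : D) : IsArtinianObject (op X) ↔ IsNoetherianObject X := by
  let e := Abelian.subobjectIsoSubobjectOp X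
  rw [isArtinianObject_iff_antitone_chain_condition, isNoetherianObject_iff_monotone_chain_condition]
  constructor
  · intro h f
    obtain ⟨n, hn⟩ := h (e.toOrderEmbedding.toOrderHom.comp f)
    exact ⟨n, fun m hm => e.injective (hn m hm)⟩
  · intro h f
    obtain ⟨n, hn⟩ := h (e.symm.toOrderEmbedding.toOrderHom.comp f)
    exact ⟨n, fun m hm => e.symm.injective (hn m hm)⟩

/-- Dually, **`op X` is noetherian iff `X` is artinian**. [cite: Atiyah1956, §3 (remark after the Definitions)]
[cite: Krause2015KS, §5 «Finite length objects»] -/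
theorem isNoetherianObject_op_iff_isArtinianObject (X : D) : IsNoetherianObject (op X) ↔ IsArtinianObject X := by
  let e : Subobject (op X) ≃o (Subobject X)ᵒᵈ := (OrderIso.dualDual (Subobject (op X))).trans (Abelian.subobjectIsoSubobjectOp X).dual.symm
  rw [isArtinianObject_iff_antitone_chain_condition, isNoetherianObject_iff_monotone_chain_condition]
  constructor
  · intro h f
    obtain ⟨n, hn⟩ := h (e.symm.toOrderEmbedding.toOrderHom.comp f)
    exact ⟨n, fun m hm => e.symm.injective (hn m hm)⟩
  · intro h f
    obtain ⟨n, hn⟩ := h (e.toOrderEmbedding.toOrderHom.comp f)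
    exact ⟨n, fun m hm => e.injective (hn m hm)⟩

/-- Hence `X` is of finite length (artinian and noetherian) iff `op X` is. [cite: Krause2015KS, §5 «Finite length objects»]
[cite: Atiyah1956, §3 (remark after the Definitions)] -/
theorem isArtinianObject_and_isNoetherianObject_op_iff (X : D) :
    IsArtinianObject (op X) ∧ IsNoetherianObject (op X) ↔ IsArtinianObject X ∧ IsNoetherianObject X := by
  rw [isArtinianObject_op_iff_isNoetherianObject, isNoetherianObject_op_iff_isArtinianObject, and_comm]

/-- With the duality, g41-#2's Lemma 5.1 (`bichainCondition_of_isArtinianObject_of_isNoetherianObject`, proved there through kernels and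
pullbacks) is also the abelian case of §3's any-category statement: a noetherian object of an abelian category has artinian opposite.
Recorded as the `αₙ`-half for noetherian objects obtained by duality. [cite: Krause2015KS, §5 Lemma 5.1] [cite: Atiyah1956, §3 (remark after the Definitions)] -/
theorem Bichain.eventually_isIso_fwd_of_isNoetherianObject' (B : Bichain D) {X : D} [IsNoetherianObject X] (e : X ≅ B.obj 0) :
    ∃ n₀ : ℕ, ∀ n, n₀ ≤ n → IsIso (B.fwd n) := by
  haveI : IsArtinianObject (op X) := (isArtinianObject_op_iff_isNoetherianObject X).2 inferInstance
  exact B.eventually_isIso_fwd_of_isArtinianObject_op e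

end Abelian

end Literature.CategoryTheory.KrullSchmidt
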